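import Summits.BirchSwinnertonDyer.BirchSwinnertonDyer.Theorems.ByReductionTypeAtTwoMultTowerSplitOrderTransport
import Summits.BirchSwinnertonDyer.BirchSwinnertonDyer.Theorems.ByReductionTypeAtTwoMultTowerSplitTowerAlgebra
import Summits.BirchSwinnertonDyer.BirchSwinnertonDyer.Theorems.ByReductionTypeAtTwoEulerCharCoinvExact
import Mathlib.Data.ZMod.QuotientGroup
import HarnessLib

/-!
# Route `ByReductionTypeAtTwo`, crux `MultUpperHalfAtTwo` (item stmt-BirchSwinnertonDyer-19922), TOWER road, SPLIT rows:
# the EXACT order of the local tower kernel at a split multiplicative prime, part 1 (any prime `p`) — a relative norm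
# `N_{F_{n+w}/F_n}(x) = q_E` produces a coinvariant class of order EXACTLY `p^w`, hence `p^w ≤ #𝒦_{v,n}[p^∞]`

HONEST FRAMING (cell `bsd-2adic`, run/shared/lean/pub/bsd-2adic/, seat `bsd-2adic-tower-1` GEN 27, HUMAN RULINGS
D-0036 / D-0054 / D-0074): TOOL theorems only (no definition, no named fact, no `sorry`); closes nothing by itself;
nothing booked; BSD is not proved by any of this. First module of the LOWER half of the PRINT binder
`hSP = Greenberg1999.sec3_natCard_localTowerKerPrimary_splitMultiplicative_rat` (Greenberg, LNM 1716, §3 pp. 92–93: at a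
SPLIT multiplicative `v ∣ p`, `|ker(r_{v_n})| ∼ log_p(N q_E)/2p[…]`, i.e. over `ℚ`: `#𝒦_{v,n}[p^∞] = p^e`,
`e + ord_p(2p) = ord_p(log_p q_E)`). Seat bsd-2adic-mult GEN 13 proved the UPPER half at `p = 2`
(`MultTowerSplitOrder.finite_and_natCard_localTowerKerPrimary_le_pow_splitTwo`); the EQUALITY needs classes that
SURVIVE, and this file supplies them from a relative norm (the existence of the norm — local class field theory for the
cyclic layer `F_{n+w}/F_n` and the norm group of `F_m/ℚ_p` — is parts 2–3).

Setting (any prime `p`): `κ` the cyclotomic `ℤ_p`-extension, `v ∋ p`, `K = ℚ_v`, `H_m`/`H_∞` the local layer subgroups,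
`Φ : K̄ˣ ↠ E(K̄)` the split Tate uniformisation with kernel `Q^ℤ` (`Q = q_E ∈ K`, `Γ`-fixed, no power equal to `1`) and
`σ • Φ(u) = Φ(σu)`, `M_∞ = E(K̄)^{H_∞}`, `g ∈ H_n` with `κ(res g) = p^n u_g` (`u_g` a unit), `N_R(x) = ∏_{i<p^R} g^i x`.

* `pow_smul_sub_mem_range_subOne`, `sum_pow_smul_sub_nsmul_mem_range_subOne` — in `M^N`:
  `g^i m − m ∈ (g−1)M^N` and `∑_{i<k} g^i m − k·m ∈ (g−1)M^N` (the group-ring identity `∑_{i<k} g^i ≡ k (mod g − 1)`);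
* `nsmul_pow_mk_eq_zero_of_prod_smul_eq` — if `N_w(x) = Q` then the class `[Φ x]` of `M_∞/(g−1)M_∞` is killed by `p^w`
  (`p^w·Φx ≡ Φ(N_w x) = Φ(Q) = 0`);
* `nsmul_pow_mk_ne_zero_of_prod_smul_eq` — … and NOT by `p^{w'}` for `w' < w`, when `x` is fixed by `H_{n+w}`:
  `x^{p^{w'}} = Q^j · gz/z` with `z ∈ K̄^{H_∞}` forces, after the orbit product `N_{R₀+w}` at a common finite level,
  `p^{R₀ + w'} = j·p^{R₀ + w}` — impossible;
* `addOrderOf_mk_eq_pow_of_prod_smul_eq` — so the class has additive order exactly `p^w`;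
* `pow_le_natCard_primaryComponent_coinvariants_of_prod_smul_eq` — **`p^w ≤ #(M_∞/(g−1)M_∞)[p^∞]`** (the cyclic subgroup
  it generates), and `pow_le_natCard_localTowerKerPrimary_of_prod_smul_eq` — **`p^w ≤ #𝒦_{v,n}[p^∞]`** through the EXACT
  local inflation–restriction count `GoodOrdTower.natCard_localTowerKerPrimary_eq_coinv_atP` (any `W`, any `p`).

References: R. Greenberg, LNM 1716 (1999), §3 pp. 85–93 (between Prop. 3.6 and 3.7); J. Silverman, GTM 151, V.3–V.5;
J. Neukirch, *ANT* IV (3.5); cell memos NOTE-SP1ONE.md §5, NOTE-HNS2-KERNEL-GEN27.md.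
-/

set_option autoImplicit false
-- the Theorems namespace of this sub repeats the summit name by design (D-0017 nested layout: Summit.<S>.<Sub>)
set_option linter.dupNamespace false

noncomputable section

open scoped Classical

universe u

namespace Summit.BirchSwinnertonDyer.BirchSwinnertonDyer.Theorems.MultTowerSplitExact

open NumberField IsDedekindDomain Field WeierstrassCurve PadicInt Rat.HeightOneSpectrum
  Literature.NumberTheory.EllipticCurves Literature.NumberTheory.EllipticCurves.ResKernel
  Literature.NumberTheory.GaloisRepresentations
  Summit.BirchSwinnertonDyer.BirchSwinnertonDyer.Theorems.MultTowerNS2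
  Summit.BirchSwinnertonDyer.BirchSwinnertonDyer.Theorems.MultTowerSplitOrder

/-! ### `∑_{i<k} g^i ≡ k (mod g − 1)` on the fixed-point module -/

section SubOne

variable {G : Type u} [Group G] (N : Subgroup G) [N.Normal] {M : Type u} [AddCommGroup M] [DistribMulAction G M]

/-- `g^i m − m ∈ (g − 1)M^N` for `m ∈ M^N`. [folklore] -/
theorem pow_smul_sub_mem_range_subOne (g : G) (m : FixedPoints.addSubgroup N M) (i : ℕ) :
    (⟨(g ^ i) • (m : M), smul_mem_fixedPoints_of_normal (g ^ i) m.2⟩ - m : FixedPoints.addSubgroup N M) ∈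
      (subOne N M g).range := by
  induction i with
  | zero =>
    have h0 : (⟨(g ^ 0) • (m : M), smul_mem_fixedPoints_of_normal (g ^ 0) m.2⟩ : FixedPoints.addSubgroup N M) = m :=
      Subtype.ext (by change (g ^ 0) • (m : M) = (m : M); rw [pow_zero, one_smul])
    rw [h0, sub_self]
    exact zero_mem _
  | succ i ih =>
    set mi : FixedPoints.addSubgroup N M := ⟨(g ^ i) • (m : M), smul_mem_fixedPoints_of_normal (g ^ i) m.2⟩ with hmi
    have hstep : (⟨(g ^ (i + 1)) • (m : M), smul_mem_fixedPoints_of_normal (g ^ (i + 1)) m.2⟩ :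
        FixedPoints.addSubgroup N M) = subOne N M g mi + mi := by
      apply Subtype.ext
      change (g ^ (i + 1)) • (m : M) = (g • ((g ^ i) • (m : M)) - (g ^ i) • (m : M)) + (g ^ i) • (m : M)
      rw [pow_succ', mul_smul, sub_add_cancel]
    rw [hstep, add_sub_assoc]
    exact add_mem ⟨mi, rfl⟩ ih

/-- `∑_{i<k} g^i m − k·m ∈ (g − 1)M^N` for `m ∈ M^N` — the group-ring identity `∑_{i<k} g^i ≡ k (mod g − 1)`.
[folklore] -/
theorem sum_pow_smul_sub_nsmul_mem_range_subOne (g : G) (m : FixedPoints.addSubgroup N M) (k : ℕ) :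
    ((∑ i ∈ Finset.range k,
        (⟨(g ^ i) • (m : M), smul_mem_fixedPoints_of_normal (g ^ i) m.2⟩ : FixedPoints.addSubgroup N M)) - k • m) ∈
      (subOne N M g).range := by
  have h : ((∑ i ∈ Finset.range k,
      (⟨(g ^ i) • (m : M), smul_mem_fixedPoints_of_normal (g ^ i) m.2⟩ : FixedPoints.addSubgroup N M)) - k • m) =
      ∑ i ∈ Finset.range k,
        ((⟨(g ^ i) • (m : M), smul_mem_fixedPoints_of_normal (g ^ i) m.2⟩ : FixedPoints.addSubgroup N M) - m) := by
    rw [Finset.sum_sub_distrib, Finset.sum_const, Finset.card_range]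
  rw [h]
  exact AddSubgroup.sum_mem _ fun i _ ↦ pow_smul_sub_mem_range_subOne N g m i

end SubOne

/-! ### The class of `Φ(x)` for `N_w(x) = Q`: order exactly `p^w` -/

variable {p : ℕ} [hp : Fact p.Prime] {κ : ZpExtension ℚ p}

/-- **`p^w · [Φ x] = 0`** in `M_∞/(g−1)M_∞` when `N_w(x) = ∏_{i<p^w} g^i x = Q` (for a point `m₀ = Φ(x)` of `M_∞`):
`∑_{i<p^w} g^i Φ(x) = Φ(N_w x) = Φ(Q) = 0` and `∑ g^i ≡ p^w (mod g − 1)`.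
[cite: GreenbergLNM1716, §3 (pp. 90–93)] [cite: SilvermanATAEC1994, Thm. V.3.1 (c)(d), Thm. V.5.3] -/
theorem nsmul_pow_mk_eq_zero_of_prod_smul_eq (v : HeightOneSpectrum (𝓞 ℚ)) {W : WeierstrassCurve ℚ}
    {Φ : Additive (AlgebraicClosure (v.adicCompletion ℚ))ˣ →+ localPoints W (v.adicCompletion ℚ)}
    {Q : AlgebraicClosure (v.adicCompletion ℚ)}
    (hker : ∀ u : (AlgebraicClosure (v.adicCompletion ℚ))ˣ, Φ (Additive.ofMul u) = 0 ↔
      ∃ j : ℤ, (u : AlgebraicClosure (v.adicCompletion ℚ)) = Q ^ j)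
    (hequiv : ∀ (σ : absoluteGaloisGroup (v.adicCompletion ℚ)) (u u' : (AlgebraicClosure (v.adicCompletion ℚ))ˣ),
      (u' : AlgebraicClosure (v.adicCompletion ℚ)) = σ • (u : AlgebraicClosure (v.adicCompletion ℚ)) →
        σ • Φ (Additive.ofMul u) = Φ (Additive.ofMul u'))
    (g : absoluteGaloisGroup (v.adicCompletion ℚ)) (w : ℕ) {x : (AlgebraicClosure (v.adicCompletion ℚ))ˣ}
    (hNx : (∏ i ∈ Finset.range (p ^ w), (g ^ i) • (x : AlgebraicClosure (v.adicCompletion ℚ))) = Q)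
    (m₀ : FixedPoints.addSubgroup (localSubgroup κ.kerSubgroup (v.adicCompletion ℚ)) (localPoints W (v.adicCompletion ℚ)))
    (hm₀ : (m₀ : localPoints W (v.adicCompletion ℚ)) = Φ (Additive.ofMul x)) :
    p ^ w • (QuotientAddGroup.mk m₀ :
      FixedPoints.addSubgroup (localSubgroup κ.kerSubgroup (v.adicCompletion ℚ)) (localPoints W (v.adicCompletion ℚ)) ⧸
        (subOne (localSubgroup κ.kerSubgroup (v.adicCompletion ℚ)) (localPoints W (v.adicCompletion ℚ)) g).range) = 0 := by
  rw [← QuotientAddGroup.mk_nsmul, QuotientAddGroup.eq_zero_iff]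
  -- `∑ g^i m₀ − p^w m₀ ∈ (g−1)M` and `∑ g^i m₀ = Φ(N_w x) = 0`
  have hsum := sum_pow_smul_sub_nsmul_mem_range_subOne (localSubgroup κ.kerSubgroup (v.adicCompletion ℚ)) g m₀ (p ^ w)
  -- the units `g^i x`
  set u : ℕ → (AlgebraicClosure (v.adicCompletion ℚ))ˣ := fun i ↦
    Units.mk0 ((g ^ i) • (x : AlgebraicClosure (v.adicCompletion ℚ))) ((smul_ne_zero_iff_ne _).mpr x.ne_zero) with hu
  have hux : ∀ i, (g ^ i) • Φ (Additive.ofMul x) = Φ (Additive.ofMul (u i)) := fun i ↦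
    hequiv (g ^ i) x (u i) (by rw [hu, Units.val_mk0])
  have hprod : Φ (Additive.ofMul (∏ i ∈ Finset.range (p ^ w), u i)) = 0 := by
    rw [hker]
    refine ⟨1, ?_⟩
    rw [zpow_one, Units.coe_prod, ← hNx]
    exact Finset.prod_congr rfl fun i _ ↦ by rw [hu, Units.val_mk0]
  have hzero : (∑ i ∈ Finset.range (p ^ w),
      (⟨(g ^ i) • (m₀ : localPoints W (v.adicCompletion ℚ)), smul_mem_fixedPoints_of_normal (g ^ i) m₀.2⟩ :
        FixedPoints.addSubgroup (localSubgroup κ.kerSubgroup (v.adicCompletion ℚ)) (localPoints W (v.adicCompletion ℚ)))) =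
      0 := by
    apply Subtype.ext
    rw [AddSubmonoidClass.coe_finsetSum, ZeroMemClass.coe_zero]
    change (∑ i ∈ Finset.range (p ^ w), (g ^ i) • (m₀ : localPoints W (v.adicCompletion ℚ))) = 0
    rw [hm₀, Finset.sum_congr rfl fun i _ ↦ hux i, ← map_sum, ← ofMul_prod, hprod]
  rw [hzero, zero_sub, neg_mem_iff] at hsum
  exact hsum

/-- **`p^{w'} · [Φ x] ≠ 0` for `w' < w`** in `M_∞/(g−1)M_∞`, when `x ∈ K̄ˣ` is fixed by `H_{n+w}`, `N_w(x) = Q`, and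
`g` generates `H_n` modulo `H_∞` (`κ(res g) = p^n u_g`): otherwise `x^{p^{w'}} = Q^j · gz/z` with `z` fixed by `H_∞`,
hence by a finite `H_{R₀}`; the orbit product `N_{R₀+w}` gives `Q^{p^{R₀+w'}} = Q^{j p^{R₀+w}}`, i.e.
`p^{R₀+w'} = j·p^{R₀+w}`, impossible for `w' < w`. [cite: GreenbergLNM1716, §3 (pp. 90–93)]
[cite: SilvermanATAEC1994, Thm. V.3.1 (c)(d), Thm. V.5.3] -/
theorem nsmul_pow_mk_ne_zero_of_prod_smul_eq (v : HeightOneSpectrum (𝓞 ℚ)) {W : WeierstrassCurve ℚ}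
    {Φ : Additive (AlgebraicClosure (v.adicCompletion ℚ))ˣ →+ localPoints W (v.adicCompletion ℚ)}
    {Q : AlgebraicClosure (v.adicCompletion ℚ)} (hsurj : Function.Surjective Φ)
    (hker : ∀ u : (AlgebraicClosure (v.adicCompletion ℚ))ˣ, Φ (Additive.ofMul u) = 0 ↔
      ∃ j : ℤ, (u : AlgebraicClosure (v.adicCompletion ℚ)) = Q ^ j)
    (hequiv : ∀ (σ : absoluteGaloisGroup (v.adicCompletion ℚ)) (u u' : (AlgebraicClosure (v.adicCompletion ℚ))ˣ),
      (u' : AlgebraicClosure (v.adicCompletion ℚ)) = σ • (u : AlgebraicClosure (v.adicCompletion ℚ)) →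
        σ • Φ (Additive.ofMul u) = Φ (Additive.ofMul u'))
    (hQfix : ∀ σ : absoluteGaloisGroup (v.adicCompletion ℚ), σ • Q = Q) (hQ0 : Q ≠ 0)
    (hQtor : ∀ j : ℤ, Q ^ j = 1 → j = 0)
    (n : ℕ) {g : absoluteGaloisGroup (v.adicCompletion ℚ)} {ug : ℤ_[p]ˣ}
    (hug : ((κ (resGal (K := ℚ) (v.adicCompletion ℚ) g)).toAdd : ℤ_[p]) = (p : ℤ_[p]) ^ n * (ug : ℤ_[p]))
    (w : ℕ) {x : (AlgebraicClosure (v.adicCompletion ℚ))ˣ}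
    (hxw : ∀ h ∈ localSubgroup (κ.layerSubgroup (n + w)) (v.adicCompletion ℚ),
      h • (x : AlgebraicClosure (v.adicCompletion ℚ)) = x)
    (hNx : (∏ i ∈ Finset.range (p ^ w), (g ^ i) • (x : AlgebraicClosure (v.adicCompletion ℚ))) = Q)
    (m₀ : FixedPoints.addSubgroup (localSubgroup κ.kerSubgroup (v.adicCompletion ℚ)) (localPoints W (v.adicCompletion ℚ)))
    (hm₀ : (m₀ : localPoints W (v.adicCompletion ℚ)) = Φ (Additive.ofMul x)) {w' : ℕ} (hw' : w' < w) :
    p ^ w' • (QuotientAddGroup.mk m₀ :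
      FixedPoints.addSubgroup (localSubgroup κ.kerSubgroup (v.adicCompletion ℚ)) (localPoints W (v.adicCompletion ℚ)) ⧸
        (subOne (localSubgroup κ.kerSubgroup (v.adicCompletion ℚ)) (localPoints W (v.adicCompletion ℚ)) g).range) ≠ 0 := by
  have hanti : ∀ {m m' : ℕ}, m ≤ m' → localSubgroup (κ.layerSubgroup m') (v.adicCompletion ℚ) ≤
      localSubgroup (κ.layerSubgroup m) (v.adicCompletion ℚ) := fun h ↦ Subgroup.comap_mono (κ.layerSubgroup_antitone h)
  intro hzero
  rw [← QuotientAddGroup.mk_nsmul, QuotientAddGroup.eq_zero_iff] at hzero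
  obtain ⟨m', hm'⟩ := hzero
  -- `m' = Φ z`, `z` fixed by `H_∞`
  obtain ⟨z, hzm, hzL⟩ := exists_unit_of_mem_fixedPoints_split (κ := κ) v hsurj hker hequiv hQfix hQ0 hQtor
    (m := (m' : localPoints W (v.adicCompletion ℚ))) (fun h hh ↦ m'.2 ⟨h, hh⟩)
  -- `Φ (x^{p^w'}) = Φ (gz/z)`, so `x^{p^w'} = Q^j · gz/z`
  set gz : (AlgebraicClosure (v.adicCompletion ℚ))ˣ :=
    Units.mk0 (g • (z : AlgebraicClosure (v.adicCompletion ℚ))) ((smul_ne_zero_iff_ne g).mpr z.ne_zero) with hgz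
  have hgΦ : g • Φ (Additive.ofMul z) = Φ (Additive.ofMul gz) := hequiv g z gz (by rw [hgz, Units.val_mk0])
  have h3 : Φ (Additive.ofMul (x ^ p ^ w')) = Φ (Additive.ofMul (gz * z⁻¹)) := by
    rw [ofMul_pow, map_nsmul, ofMul_mul, ofMul_inv, map_add, map_neg, ← hgΦ, hzm, ← sub_eq_add_neg, ← hm₀]
    have h4 := congrArg (fun b : FixedPoints.addSubgroup (localSubgroup κ.kerSubgroup (v.adicCompletion ℚ))
      (localPoints W (v.adicCompletion ℚ)) ↦ (b : localPoints W (v.adicCompletion ℚ))) hm'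
    simp only [coe_subOne_apply, AddSubgroupClass.coe_nsmul] at h4
    exact h4.symm
  rw [tatePsi_eq_iff v hker] at h3
  obtain ⟨j, hj⟩ := h3
  rw [Units.val_pow_eq_pow_val, Units.val_mul, Units.val_inv_eq_inv_val, hgz, Units.val_mk0, ← div_eq_mul_inv] at hj
  -- a finite level `R₀` fixing `z`; `R := R₀ + w`
  obtain ⟨R₀, hR₀⟩ := MultTowerSP1.exists_forall_mem_localSubgroup_layerSubgroup_smul_eq (κ := κ) v
    (z : AlgebraicClosure (v.adicCompletion ℚ)) hzL
  have hzR : ∀ h ∈ localSubgroup (κ.layerSubgroup (n + (R₀ + w))) (v.adicCompletion ℚ),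
      h • (z : AlgebraicClosure (v.adicCompletion ℚ)) = z :=
    fun h hh ↦ hR₀ h (hanti (m := R₀) (m' := n + (R₀ + w)) (by omega) hh)
  have hgR : g ^ p ^ (R₀ + w) ∈ localSubgroup (κ.layerSubgroup (n + (R₀ + w))) (v.adicCompletion ℚ) :=
    (MultTowerSP1.pow_mem_localSubgroup_layerSubgroup_iff (κ := κ) v n (R₀ + w) hug _).mpr dvd_rfl
  have hgw : g ^ p ^ w ∈ localSubgroup (κ.layerSubgroup (n + w)) (v.adicCompletion ℚ) :=
    (MultTowerSP1.pow_mem_localSubgroup_layerSubgroup_iff (κ := κ) v n w hug _).mpr dvd_rfl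
  have hgRz : (g ^ p ^ (R₀ + w)) • (z : AlgebraicClosure (v.adicCompletion ℚ)) = z := hzR _ hgR
  have hgwx : (g ^ p ^ w) • (x : AlgebraicClosure (v.adicCompletion ℚ)) = x := hxw _ hgw
  -- orbit products `N_{R₀+w}`
  have hNz : (∏ i ∈ Finset.range (p ^ (R₀ + w)), (g ^ i) • (g • (z : AlgebraicClosure (v.adicCompletion ℚ)) / z)) = 1 := by
    rw [Finset.prod_congr rfl fun i _ ↦ show (g ^ i) • (g • (z : AlgebraicClosure (v.adicCompletion ℚ)) / z) = (g ^ i) • (g • (z : AlgebraicClosure (v.adicCompletion ℚ))) * (g ^ i) • (z : AlgebraicClosure (v.adicCompletion ℚ))⁻¹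
        by rw [div_eq_mul_inv, smul_mul'], Finset.prod_mul_distrib, prod_smul_smul_eq g (p ^ (R₀ + w)) hgRz, prod_smul_inv,
      mul_inv_cancel₀]
    exact Finset.prod_ne_zero_iff.mpr fun i _ ↦ (smul_ne_zero_iff_ne _).mpr z.ne_zero
  have hNx' : (∏ i ∈ Finset.range (p ^ (R₀ + w)), (g ^ i) • (x : AlgebraicClosure (v.adicCompletion ℚ))) = Q ^ p ^ R₀ := by
    rw [pow_add, mul_comm, MultTowerSP1.prod_smul_range_mul_eq_pow g (p ^ w) hgwx (p ^ R₀), hNx]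
  have hQi : ∀ i : ℕ, (g ^ i) • Q = Q := fun i ↦ by
    induction i with
    | zero => rw [pow_zero, one_smul]
    | succ i ih => rw [pow_succ, mul_smul, hQfix, ih]
  have hL : (∏ i ∈ Finset.range (p ^ (R₀ + w)), (g ^ i) • ((x : AlgebraicClosure (v.adicCompletion ℚ)) ^ p ^ w')) = Q ^ (p ^ R₀ * p ^ w') := by
    rw [MultTowerSP1.prod_smul_pow, hNx', ← pow_mul]
  have hRHS : (∏ i ∈ Finset.range (p ^ (R₀ + w)), (g ^ i) • (Q ^ j * (g • (z : AlgebraicClosure (v.adicCompletion ℚ)) / z))) = (Q ^ j) ^ p ^ (R₀ + w) := by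
    rw [Finset.prod_congr rfl fun i _ ↦
        show (g ^ i) • (Q ^ j * (g • (z : AlgebraicClosure (v.adicCompletion ℚ)) / z)) = Q ^ j * (g ^ i) • (g • (z : AlgebraicClosure (v.adicCompletion ℚ)) / z) by
          rw [smul_mul', smul_zpow₀', hQi],
      Finset.prod_mul_distrib, hNz, mul_one, Finset.prod_const, Finset.card_range]
  have key : Q ^ (p ^ R₀ * p ^ w') = (Q ^ j) ^ p ^ (R₀ + w) := by
    rw [← hL, ← hRHS]
    exact Finset.prod_congr rfl fun i _ ↦ by rw [hj]
  rw [← zpow_natCast, ← zpow_natCast, ← zpow_mul] at key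
  -- compare exponents
  have hinj : ∀ a b : ℤ, Q ^ a = Q ^ b → a = b := fun a b hab ↦ by
    have h1 : Q ^ (a - b) = 1 := by rw [zpow_sub₀ hQ0, hab, div_self (zpow_ne_zero _ hQ0)]
    have := hQtor _ h1
    omega
  have hexp := hinj _ _ key
  push_cast at hexp
  -- `p^{R₀} p^{w'} = j p^{R₀ + w}` with `w' < w`: impossible
  have hp0 : (0 : ℤ) < p := by exact_mod_cast hp.out.pos
  have hlt : (p : ℤ) ^ R₀ * (p : ℤ) ^ w' < (p : ℤ) ^ R₀ * (p : ℤ) ^ w := by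
    have hp1 : (1 : ℤ) < p := by exact_mod_cast hp.out.one_lt
    exact mul_lt_mul_of_pos_left (pow_lt_pow_right₀ hp1 hw') (pow_pos hp0 _)
  have hpos : (0 : ℤ) < (p : ℤ) ^ R₀ * (p : ℤ) ^ w' := by positivity
  have hdvd : ((p : ℤ) ^ R₀ * (p : ℤ) ^ w) ∣ (p : ℤ) ^ R₀ * (p : ℤ) ^ w' := by
    refine ⟨j, ?_⟩
    rw [hexp, pow_add]
    ring
  exact absurd (Int.le_of_dvd hpos hdvd) (not_le.mpr hlt)

/-- **The class `[Φ x]` has additive order exactly `p^w`** (`x` fixed by `H_{n+w}`, `N_w(x) = Q`).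
[cite: GreenbergLNM1716, §3 (pp. 90–93)] -/
theorem addOrderOf_mk_eq_pow_of_prod_smul_eq (v : HeightOneSpectrum (𝓞 ℚ)) {W : WeierstrassCurve ℚ}
    {Φ : Additive (AlgebraicClosure (v.adicCompletion ℚ))ˣ →+ localPoints W (v.adicCompletion ℚ)}
    {Q : AlgebraicClosure (v.adicCompletion ℚ)} (hsurj : Function.Surjective Φ)
    (hker : ∀ u : (AlgebraicClosure (v.adicCompletion ℚ))ˣ, Φ (Additive.ofMul u) = 0 ↔
      ∃ j : ℤ, (u : AlgebraicClosure (v.adicCompletion ℚ)) = Q ^ j)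
    (hequiv : ∀ (σ : absoluteGaloisGroup (v.adicCompletion ℚ)) (u u' : (AlgebraicClosure (v.adicCompletion ℚ))ˣ),
      (u' : AlgebraicClosure (v.adicCompletion ℚ)) = σ • (u : AlgebraicClosure (v.adicCompletion ℚ)) →
        σ • Φ (Additive.ofMul u) = Φ (Additive.ofMul u'))
    (hQfix : ∀ σ : absoluteGaloisGroup (v.adicCompletion ℚ), σ • Q = Q) (hQ0 : Q ≠ 0)
    (hQtor : ∀ j : ℤ, Q ^ j = 1 → j = 0)
    (n : ℕ) {g : absoluteGaloisGroup (v.adicCompletion ℚ)} {ug : ℤ_[p]ˣ}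
    (hug : ((κ (resGal (K := ℚ) (v.adicCompletion ℚ) g)).toAdd : ℤ_[p]) = (p : ℤ_[p]) ^ n * (ug : ℤ_[p]))
    (w : ℕ) {x : (AlgebraicClosure (v.adicCompletion ℚ))ˣ}
    (hxw : ∀ h ∈ localSubgroup (κ.layerSubgroup (n + w)) (v.adicCompletion ℚ),
      h • (x : AlgebraicClosure (v.adicCompletion ℚ)) = x)
    (hNx : (∏ i ∈ Finset.range (p ^ w), (g ^ i) • (x : AlgebraicClosure (v.adicCompletion ℚ))) = Q)
    (m₀ : FixedPoints.addSubgroup (localSubgroup κ.kerSubgroup (v.adicCompletion ℚ)) (localPoints W (v.adicCompletion ℚ)))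
    (hm₀ : (m₀ : localPoints W (v.adicCompletion ℚ)) = Φ (Additive.ofMul x)) :
    addOrderOf (QuotientAddGroup.mk m₀ :
      FixedPoints.addSubgroup (localSubgroup κ.kerSubgroup (v.adicCompletion ℚ)) (localPoints W (v.adicCompletion ℚ)) ⧸
        (subOne (localSubgroup κ.kerSubgroup (v.adicCompletion ℚ)) (localPoints W (v.adicCompletion ℚ)) g).range) = p ^ w := by
  cases w with
  | zero =>
    rw [pow_zero, AddMonoid.addOrderOf_eq_one_iff]
    have h := nsmul_pow_mk_eq_zero_of_prod_smul_eq (κ := κ) v hker hequiv g 0 hNx m₀ hm₀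
    rwa [pow_zero, one_nsmul] at h
  | succ w =>
    exact addOrderOf_eq_prime_pow
      (nsmul_pow_mk_ne_zero_of_prod_smul_eq (κ := κ) v hsurj hker hequiv hQfix hQ0 hQtor n hug (w + 1) hxw hNx m₀ hm₀
        (Nat.lt_succ_self w))
      (nsmul_pow_mk_eq_zero_of_prod_smul_eq (κ := κ) v hker hequiv g (w + 1) hNx m₀ hm₀)

/-! ### Consequences: `p^w` surviving classes -/

/-- **`p^w ≤ #(M_∞/(g−1)M_∞)[p^∞]`** whenever some `x ∈ K̄ˣ` fixed by `H_{n+w}` has `N_w(x) = ∏_{i<p^w} g^i x = Q`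
(the cyclic subgroup generated by `[Φ x]` has order `p^w` and consists of `p`-power torsion classes).
[cite: GreenbergLNM1716, §3 (pp. 90–93)] [cite: SilvermanATAEC1994, Thm. V.3.1 (c)(d), Thm. V.5.3] -/
theorem pow_le_natCard_primaryComponent_coinvariants_of_prod_smul_eq (v : HeightOneSpectrum (𝓞 ℚ))
    {W : WeierstrassCurve ℚ}
    {Φ : Additive (AlgebraicClosure (v.adicCompletion ℚ))ˣ →+ localPoints W (v.adicCompletion ℚ)}
    {Q : AlgebraicClosure (v.adicCompletion ℚ)} (hsurj : Function.Surjective Φ)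
    (hker : ∀ u : (AlgebraicClosure (v.adicCompletion ℚ))ˣ, Φ (Additive.ofMul u) = 0 ↔
      ∃ j : ℤ, (u : AlgebraicClosure (v.adicCompletion ℚ)) = Q ^ j)
    (hequiv : ∀ (σ : absoluteGaloisGroup (v.adicCompletion ℚ)) (u u' : (AlgebraicClosure (v.adicCompletion ℚ))ˣ),
      (u' : AlgebraicClosure (v.adicCompletion ℚ)) = σ • (u : AlgebraicClosure (v.adicCompletion ℚ)) →
        σ • Φ (Additive.ofMul u) = Φ (Additive.ofMul u'))
    (hQfix : ∀ σ : absoluteGaloisGroup (v.adicCompletion ℚ), σ • Q = Q) (hQ0 : Q ≠ 0)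
    (hQtor : ∀ j : ℤ, Q ^ j = 1 → j = 0)
    (n : ℕ) {g : absoluteGaloisGroup (v.adicCompletion ℚ)} {ug : ℤ_[p]ˣ}
    (hug : ((κ (resGal (K := ℚ) (v.adicCompletion ℚ) g)).toAdd : ℤ_[p]) = (p : ℤ_[p]) ^ n * (ug : ℤ_[p]))
    (w : ℕ) {x : (AlgebraicClosure (v.adicCompletion ℚ))ˣ}
    (hxw : ∀ h ∈ localSubgroup (κ.layerSubgroup (n + w)) (v.adicCompletion ℚ),
      h • (x : AlgebraicClosure (v.adicCompletion ℚ)) = x)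
    (hNx : (∏ i ∈ Finset.range (p ^ w), (g ^ i) • (x : AlgebraicClosure (v.adicCompletion ℚ))) = Q)
    [Finite (AddCommGroup.primaryComponent
      (FixedPoints.addSubgroup (localSubgroup κ.kerSubgroup (v.adicCompletion ℚ)) (localPoints W (v.adicCompletion ℚ)) ⧸
        (subOne (localSubgroup κ.kerSubgroup (v.adicCompletion ℚ)) (localPoints W (v.adicCompletion ℚ)) g).range) p)] :
    p ^ w ≤ Nat.card (AddCommGroup.primaryComponent
      (FixedPoints.addSubgroup (localSubgroup κ.kerSubgroup (v.adicCompletion ℚ)) (localPoints W (v.adicCompletion ℚ)) ⧸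
        (subOne (localSubgroup κ.kerSubgroup (v.adicCompletion ℚ)) (localPoints W (v.adicCompletion ℚ)) g).range) p) := by
  set P := localPoints W (v.adicCompletion ℚ) with hP
  set Hi := localSubgroup κ.kerSubgroup (v.adicCompletion ℚ) with hHi
  set M : AddSubgroup P := FixedPoints.addSubgroup Hi P with hM
  set d : M →+ M := subOne Hi P g with hd
  have hxL : ∀ h ∈ Hi, h • (x : AlgebraicClosure (v.adicCompletion ℚ)) = x :=
    fun h hh ↦ hxw h (localSubgroup_ker_le_layer κ (v.adicCompletion ℚ) (n + w) hh)
  set m₀ : M := ⟨Φ (Additive.ofMul x), fun h ↦ apply_mem_fixedPoints_split v hequiv Hi hxL h h.2⟩ with hm₀def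
  have hm₀ : (m₀ : P) = Φ (Additive.ofMul x) := rfl
  set y : M ⧸ d.range := QuotientAddGroup.mk m₀ with hy
  have hord : addOrderOf y = p ^ w :=
    addOrderOf_mk_eq_pow_of_prod_smul_eq (κ := κ) v hsurj hker hequiv hQfix hQ0 hQtor n hug w hxw hNx m₀ hm₀
  -- the cyclic subgroup `ℤ y` sits inside the `p`-primary component
  set C : AddSubgroup (M ⧸ d.range) := AddSubgroup.zmultiples y with hC
  have hCle : ∀ c ∈ C, c ∈ AddCommGroup.primaryComponent (M ⧸ d.range) p := by
    intro c hc
    rw [hC, AddSubgroup.mem_zmultiples_iff] at hc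
    obtain ⟨k, rfl⟩ := hc
    refine (AddCommGroup.mem_primaryComponent).mpr ⟨w, ?_⟩
    rw [smul_comm, ← hord, addOrderOf_nsmul_eq_zero, smul_zero]
  have hcardC : Nat.card C = p ^ w := by rw [hC, Nat.card_zmultiples, hord]
  let ι : C → AddCommGroup.primaryComponent (M ⧸ d.range) p := fun c ↦ ⟨c.1, hCle c.1 c.2⟩
  have hι : Function.Injective ι := fun a b h ↦ by
    apply Subtype.ext
    have h' := congrArg Subtype.val h
    exact h'
  rw [← hcardC]
  exact Nat.card_le_card_of_injective ι hι

/-- **`p^w ≤ #𝒦_{v,n}[p^∞]`** — same hypotheses, `κ` cyclotomic, through the EXACT local inflation–restriction count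
`GoodOrdTower.natCard_localTowerKerPrimary_eq_coinv_atP` (`#𝒦_{v,n}[p^∞] = #(M_∞/(g−1)M_∞)[p^∞]`, any `W`, any `p`).
[cite: GreenbergLNM1716, §3 (pp. 85–93)] [cite: SilvermanATAEC1994, Thm. V.3.1 (c)(d), Thm. V.5.3] -/
theorem pow_le_natCard_localTowerKerPrimary_of_prod_smul_eq (hκ : κ.IsCyclotomic) (v : HeightOneSpectrum (𝓞 ℚ))
    (hv : ((p : ℕ) : 𝓞 ℚ) ∈ v.asIdeal) (W : WeierstrassCurve ℚ) [W.IsElliptic]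
    {Φ : Additive (AlgebraicClosure (v.adicCompletion ℚ))ˣ →+ localPoints W (v.adicCompletion ℚ)}
    {Q : AlgebraicClosure (v.adicCompletion ℚ)} (hsurj : Function.Surjective Φ)
    (hker : ∀ u : (AlgebraicClosure (v.adicCompletion ℚ))ˣ, Φ (Additive.ofMul u) = 0 ↔
      ∃ j : ℤ, (u : AlgebraicClosure (v.adicCompletion ℚ)) = Q ^ j)
    (hequiv : ∀ (σ : absoluteGaloisGroup (v.adicCompletion ℚ)) (u u' : (AlgebraicClosure (v.adicCompletion ℚ))ˣ),
      (u' : AlgebraicClosure (v.adicCompletion ℚ)) = σ • (u : AlgebraicClosure (v.adicCompletion ℚ)) →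
        σ • Φ (Additive.ofMul u) = Φ (Additive.ofMul u'))
    (hQfix : ∀ σ : absoluteGaloisGroup (v.adicCompletion ℚ), σ • Q = Q) (hQ0 : Q ≠ 0)
    (hQtor : ∀ j : ℤ, Q ^ j = 1 → j = 0)
    (n : ℕ) {g : absoluteGaloisGroup (v.adicCompletion ℚ)}
    (hgn : g ∈ localSubgroup (κ.layerSubgroup n) (v.adicCompletion ℚ))
    (hgen : ∀ U : Subgroup (absoluteGaloisGroup (v.adicCompletion ℚ)),
      IsOpen (U : Set (absoluteGaloisGroup (v.adicCompletion ℚ))) →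
        localSubgroup κ.kerSubgroup (v.adicCompletion ℚ) ≤ U → g ∈ U →
          localSubgroup (κ.layerSubgroup n) (v.adicCompletion ℚ) ≤ U)
    (w : ℕ) {x : (AlgebraicClosure (v.adicCompletion ℚ))ˣ}
    (hxw : ∀ h ∈ localSubgroup (κ.layerSubgroup (n + w)) (v.adicCompletion ℚ),
      h • (x : AlgebraicClosure (v.adicCompletion ℚ)) = x)
    (hNx : (∏ i ∈ Finset.range (p ^ w), (g ^ i) • (x : AlgebraicClosure (v.adicCompletion ℚ))) = Q)
    [Finite (AddCommGroup.primaryComponent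
      (FixedPoints.addSubgroup (localSubgroup κ.kerSubgroup (v.adicCompletion ℚ)) (localPoints W (v.adicCompletion ℚ)) ⧸
        (subOne (localSubgroup κ.kerSubgroup (v.adicCompletion ℚ)) (localPoints W (v.adicCompletion ℚ)) g).range) p)] :
    p ^ w ≤ Nat.card (W.localTowerKerPrimary κ (v.adicCompletion ℚ) n) := by
  obtain ⟨ug, hug⟩ := MultTowerSP1.exists_units_kappa_resGal_eq_of_generate hκ v hv n hgn hgen
  rw [GoodOrdTower.natCard_localTowerKerPrimary_eq_coinv_atP hκ v hv W n hgn hgen]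
  exact pow_le_natCard_primaryComponent_coinvariants_of_prod_smul_eq (κ := κ) v hsurj hker hequiv hQfix hQ0 hQtor n hug
    w hxw hNx

end Summit.BirchSwinnertonDyer.BirchSwinnertonDyer.Theorems.MultTowerSplitExact

end
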